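import Summits.AnomalousDissipation.AnomalousDissipation.Theorems.SawtoothPulseCascadeK1LocalisedCascadeCornerTraceTools

/-!
# K1loc, line `Spectral` — helper: THE RESIDUE COUNT OF A SOURCE INTERVAL (S-D, corner-trace grade)

The scalar `M_c` of `…CornerTraceSum.cornerTrace_sum_sq_le` / `…WindowBlockVCT.sum_windowBlock_vstep_ct_le` for the source
interval `[−Q, Q]`: every residue class mod `N` meets `[−Q, Q]` in at most `2Q/N + 1` points
(`card_filter_Icc_dvd_sub_le`).
-/

-- `Summit.<Summit>.<Problem>`: single-conjunct summit, the duplicate namespace segment is deliberate.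
set_option linter.dupNamespace false

namespace Summit.AnomalousDissipation.AnomalousDissipation.Theorems.SawtoothPulseCascade.K1Window

/-- **Residue count of an interval**: for `N ≥ 1`, `Q`, `k`, the number of `l ∈ [−Q, Q]` with `N ∣ k − l` is at most
`2Q/N + 1` (the class is an arithmetic progression of step `N` inside an interval of length `2Q`). [folklore] -/
theorem card_filter_Icc_dvd_sub_le {N : ℕ} (hN : 0 < N) (Q : ℕ) (k : ℤ) :
    ((((Finset.Icc (-(Q : ℤ)) Q).filter fun l => (N : ℤ) ∣ k - l).card : ℕ) : ℝ) ≤ 2 * Q / N + 1 := by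
  classical
  set S := (Finset.Icc (-(Q : ℤ)) Q).filter fun l => (N : ℤ) ∣ k - l with hS
  have hNz : (N : ℤ) ≠ 0 := by exact_mod_cast hN.ne'
  have hN' : (0 : ℤ) < N := by exact_mod_cast hN
  rcases S.eq_empty_or_nonempty with h0 | hne
  · rw [h0, Finset.card_empty]; push_cast; positivity
  obtain ⟨l₀, hl₀, hmin⟩ := S.exists_min_image id hne
  have hmem : ∀ l ∈ S, -(Q : ℤ) ≤ l ∧ l ≤ Q ∧ (N : ℤ) ∣ k - l := fun l hl => by
    obtain ⟨h1, h2⟩ := Finset.mem_filter.mp hl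
    exact ⟨(Finset.mem_Icc.mp h1).1, (Finset.mem_Icc.mp h1).2, h2⟩
  have hdvd : ∀ l ∈ S, (N : ℤ) ∣ l - l₀ := fun l hl => by
    have h := dvd_sub (hmem l₀ hl₀).2.2 (hmem l hl).2.2
    have e : k - l₀ - (k - l) = l - l₀ := by ring
    rwa [e] at h
  have ht0 : ∀ l ∈ S, ∀ t : ℤ, l - l₀ = N * t → 0 ≤ t := fun l hl t ht => by
    have hl0 : l₀ ≤ l := hmin l hl
    nlinarith
  have hcard : S.card ≤ (Finset.range (2 * Q / N + 1)).card := by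
    refine Finset.card_le_card_of_injOn (fun l => ((l - l₀) / N).toNat) (fun l hl => ?_) (fun l hl l' hl' h => ?_)
    · obtain ⟨h1, h2, -⟩ := hmem l (Finset.mem_coe.mp hl)
      obtain ⟨t, ht⟩ := hdvd l (Finset.mem_coe.mp hl)
      have h0 := ht0 l (Finset.mem_coe.mp hl) t ht
      simp only [Finset.mem_coe, Finset.mem_range]
      rw [ht, Int.mul_ediv_cancel_left _ hNz, Nat.lt_succ_iff, Nat.le_div_iff_mul_le hN]
      have hQ0 := (hmem l₀ hl₀).1
      have htN : t * N ≤ 2 * Q := by nlinarith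
      have e : ((t.toNat * N : ℕ) : ℤ) ≤ ((2 * Q : ℕ) : ℤ) := by
        push_cast; rw [Int.toNat_of_nonneg h0]; exact htN
      exact_mod_cast e
    · obtain ⟨t, ht⟩ := hdvd l (Finset.mem_coe.mp hl)
      obtain ⟨t', ht'⟩ := hdvd l' (Finset.mem_coe.mp hl')
      have h0 := ht0 l (Finset.mem_coe.mp hl) t ht
      have h0' := ht0 l' (Finset.mem_coe.mp hl') t' ht'
      simp only at h
      rw [ht, ht', Int.mul_ediv_cancel_left _ hNz, Int.mul_ediv_cancel_left _ hNz] at h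
      have htt : t = t' := by rw [← Int.toNat_of_nonneg h0, ← Int.toNat_of_nonneg h0', h]
      rw [htt] at ht
      linarith
  rw [Finset.card_range] at hcard
  calc (S.card : ℝ) ≤ ((2 * Q / N + 1 : ℕ) : ℝ) := by exact_mod_cast hcard
    _ ≤ 2 * Q / N + 1 := by
        have h : ((2 * Q / N : ℕ) : ℝ) ≤ ((2 * Q : ℕ) : ℝ) / (N : ℝ) := Nat.cast_div_le
        push_cast at h ⊢
        linarith

end Summit.AnomalousDissipation.AnomalousDissipation.Theorems.SawtoothPulseCascade.K1Window
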